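import Summits.ValiantsHypothesis.ValiantsHypothesis.Theorems.LacunarySymmetroidMatrixDescartesCensusV19SModel
import Summits.ValiantsHypothesis.ValiantsHypothesis.Theorems.LacunarySymmetroidMatrixDescartesCensusV19CSoundNineteen

/-!
# `MatrixDescartes` census — soundness of the 2-SIDON `V = 19` checker: signs and values of terms, the single-positive-term lemma

HONEST FRAMING.  Object-search cell `pub-symmetroid`; door-A item `DoorA26 = PosRootLawAt 2 6 19`
(stmt-ValiantsHypothesis-19979; OPEN, typed, never asserted).  Part of the proof that certificates accepted by `V19S.certOK` (`…CensusV19SCheck`)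
exclude a nineteen — `19` distinct positive det-roots of a six-term real symmetric `2 × 2` pencil — on a 2-Sidon support in the cells of Case A
(one repetition) and Case B (one zero) (semantics: `…CensusV19SModel`).  Abstract layer, the twin of `…CensusV19CSoundTerms` with slot = position:
what a `V19S.Model` says about the terms of the named inequalities (three-valued signs; a term containing the zero atom of mode `B` vanishes).
Nothing here bears on the one-collision supports, on `ζ_sym(2,6)` over all supports, on `DoorA26` itself, on `MatrixDescartes`
(stmt-ValiantsHypothesis-18050) or on `VP ≠ VNP`.

[folklore] Certificate-checker soundness; elementary.
-/

-- the D-0017 layout repeats a namespace component (single-conjunct summit); the `dupNamespace` linter flags it; name mandated.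
set_option linter.dupNamespace false

namespace Summit.ValiantsHypothesis.ValiantsHypothesis.Theorems.LacunarySymmetroidMatrixDescartes.Census.V19S

open V20 (Atom allAtoms psum posOf qA cA Term PolySpec posl oddTrues FNat fval Row rowC25 rowOne rowAmgm FRat negAt
  G3poly RCSpoly Wpoly tval pval lprod xpow frval BPos lprod_pos lprod_cons atoms_valid coeff_ne_zero qA_mem cA_mem term_getD_mem
  pval_eq_sum_range posOf_lt)

section Terms

open Finset

variable {c : Ctx} {x : ℕ → ℝ} {v : Atom → ℝ}

/-! ### Slots and signs -/

/-- `posl` over the order is the list of slots (positions). [folklore] -/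
theorem posl_ord (c : Ctx) (A : List Atom) : posl c.ord A = A.map c.slot := rfl

/-- Slots of valid atoms are positions `< 21`. [folklore] -/
theorem Model.slot_lt (M : V19S.Model c x v) {a : Atom} (ha : a ∈ allAtoms) : c.slot a < 21 := posOf_lt M.wf.hord ha

/-- The real sign of the zero atom's slot is `0`. [folklore] -/
theorem sgR_of_zero {k : ℕ} (h : zeroSlot c.mode k = true) : sgR c k = 0 := by
  unfold sgR; rw [if_pos h]

/-- The real sign of a non-zero slot is `∓1` according to `negSlot`. [folklore] -/
theorem sgR_of_not_zero {k : ℕ} (h : zeroSlot c.mode k = false) :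
    sgR c k = if negSlot c.s c.mode k then -1 else 1 := by
  unfold sgR; rw [h]; simp

/-- A zero atom evaluates to `0`. [folklore] -/
theorem Model.v_eq_zero (M : V19S.Model c x v) {a : Atom} (ha : a ∈ allAtoms) (hz : atomZero c a = true) : v a = 0 := by
  rw [M.hv a ha, sgR_of_zero (by simpa [atomZero] using hz), zero_mul]

/-- A non-zero atom evaluates to `±` its slot magnitude. [folklore] -/
theorem Model.v_eq_of_not_zero (M : V19S.Model c x v) {a : Atom} (ha : a ∈ allAtoms) (hz : atomZero c a = false) :
    v a = (if negSlot c.s c.mode (c.slot a) then -1 else 1) * x (c.slot a) := by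
  rw [M.hv a ha, sgR_of_not_zero (by simpa [atomZero] using hz)]

/-- A non-zero atom does not vanish. [folklore] -/
theorem Model.v_ne_zero (M : V19S.Model c x v) {a : Atom} (ha : a ∈ allAtoms) (hz : atomZero c a = false) : v a ≠ 0 := by
  rw [M.v_eq_of_not_zero ha hz]
  have hx := M.xpos (c.slot a)
  split_ifs <;> nlinarith

/-- Absolute value of a non-zero atom. [folklore] -/
theorem Model.abs_v (M : V19S.Model c x v) {a : Atom} (ha : a ∈ allAtoms) (hz : atomZero c a = false) : |v a| = x (c.slot a) := by
  rw [M.v_eq_of_not_zero ha hz]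
  have hx := M.xpos (c.slot a)
  split_ifs <;> simp [abs_of_pos hx]

/-- A strictly positive atom evaluates to its (positive) slot magnitude. [folklore] -/
theorem Model.v_pos (M : V19S.Model c x v) {a : Atom} (ha : a ∈ allAtoms) (hp : atomPos c a = true) : 0 < v a := by
  unfold atomPos at hp
  simp only [Bool.and_eq_true, Bool.not_eq_true'] at hp
  rw [M.hv a ha, sgR_of_not_zero hp.1, hp.2]
  simpa using M.xpos (c.slot a)

/-! ### Values of terms -/

/-- `termZero = false` unpacked: no atom of the term is the zero atom. [folklore] -/
theorem termZero_false_iff (c : Ctx) (T : Term) : termZero c T = false ↔ ∀ a ∈ T.2, zeroSlot c.mode (c.slot a) = false := by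
  unfold termZero; simp

/-- The product of signed values of non-zero atoms splits into a parity sign and the product of slot magnitudes. [folklore] -/
theorem prod_map_sgR_mul (c : Ctx) (x : ℕ → ℝ) :
    ∀ A : List Atom, (∀ a ∈ A, zeroSlot c.mode (c.slot a) = false) →
      (A.map fun a => sgR c (c.slot a) * x (c.slot a)).prod
        = (if oddTrues (A.map fun a => negSlot c.s c.mode (c.slot a)) then -1 else 1) * lprod x (A.map c.slot)
  | [], _ => by simp [oddTrues, lprod]
  | a :: A, h => by
    rw [List.map_cons, List.prod_cons, prod_map_sgR_mul c x A (fun b hb => h b (by simp [hb])),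
      sgR_of_not_zero (h a (by simp))]
    simp only [List.map_cons, oddTrues, lprod, List.prod_cons]
    cases negSlot c.s c.mode (c.slot a) <;>
      cases oddTrues (List.map (fun a => negSlot c.s c.mode (c.slot a)) A) <;> simp

/-- Under a model, a term without the zero atom is `±|γ| · ∏ x` with the sign computed by `termNeg`. [folklore] -/
theorem tval_eq_of_model (M : V19S.Model c x v) (T : Term) (hT : ∀ a ∈ T.2, a ∈ allAtoms) (hz : termZero c T = false) :
    tval v T = (if termNeg c T then -1 else 1) * |(T.1 : ℝ)| * lprod x (posl c.ord T.2) := by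
  unfold tval termNeg
  have hmap : T.2.map v = T.2.map fun a => sgR c (c.slot a) * x (c.slot a) :=
    List.map_congr_left fun a ha => M.hv a (hT a ha)
  rw [hmap, prod_map_sgR_mul c x T.2 ((termZero_false_iff c T).1 hz), posl_ord]
  have hg : (T.1 : ℝ) = (if decide (T.1 < 0) then -1 else 1) * |(T.1 : ℝ)| := by
    by_cases h : T.1 < 0
    · simp [h, abs_of_neg (show (T.1 : ℝ) < 0 by exact_mod_cast h)]
    · simp [h, abs_of_nonneg (show (0 : ℝ) ≤ T.1 by exact_mod_cast not_lt.1 h)]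
  rw [hg]
  cases decide (T.1 < 0) <;> cases oddTrues (List.map (fun a => negSlot c.s c.mode (c.slot a)) T.2) <;> simp

/-- A term containing the zero atom vanishes. [folklore] -/
theorem tval_eq_zero_of_termZero (M : V19S.Model c x v) (T : Term) (hT : ∀ a ∈ T.2, a ∈ allAtoms) (hz : termZero c T = true) :
    tval v T = 0 := by
  unfold termZero at hz
  rw [List.any_eq_true] at hz
  obtain ⟨a, ha, hza⟩ := hz
  unfold tval
  have h0 : v a = 0 := M.v_eq_zero (hT a ha) (by simpa [atomZero] using hza)
  rw [List.prod_eq_zero (List.mem_map.2 ⟨a, ha, h0⟩), mul_zero]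

/-- A negative term without the zero atom is `≤ 0`. [folklore] -/
theorem tval_nonpos_of_termNeg (M : V19S.Model c x v) (T : Term) (hT : ∀ a ∈ T.2, a ∈ allAtoms) (hz : termZero c T = false)
    (hn : termNeg c T = true) : tval v T ≤ 0 := by
  rw [tval_eq_of_model M T hT hz, hn]
  simp only [ite_true]
  have := lprod_pos M.xpos (posl c.ord T.2)
  have := abs_nonneg (T.1 : ℝ)
  nlinarith

/-- A negative term without the zero atom and with non-zero coefficient is `< 0`. [folklore] -/
theorem tval_neg_of_termNeg (M : V19S.Model c x v) (T : Term) (hT : ∀ a ∈ T.2, a ∈ allAtoms) (hz : termZero c T = false)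
    (hn : termNeg c T = true) (hγ : T.1 ≠ 0) : tval v T < 0 := by
  rw [tval_eq_of_model M T hT hz, hn]
  simp only [ite_true]
  have := lprod_pos M.xpos (posl c.ord T.2)
  have : 0 < |(T.1 : ℝ)| := abs_pos.2 (by exact_mod_cast hγ)
  nlinarith

/-- A non-negative term without the zero atom is `|γ| · ∏ x`. [folklore] -/
theorem tval_eq_of_not_termNeg (M : V19S.Model c x v) (T : Term) (hT : ∀ a ∈ T.2, a ∈ allAtoms) (hz : termZero c T = false)
    (hn : termNeg c T = false) : tval v T = |(T.1 : ℝ)| * lprod x (posl c.ord T.2) := by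
  rw [tval_eq_of_model M T hT hz, hn]; simp

/-- Absolute value of a term without the zero atom. [folklore] -/
theorem abs_tval_eq (M : V19S.Model c x v) (T : Term) (hT : ∀ a ∈ T.2, a ∈ allAtoms) (hz : termZero c T = false) :
    |tval v T| = |(T.1 : ℝ)| * lprod x (posl c.ord T.2) := by
  rw [tval_eq_of_model M T hT hz]
  have h1 := lprod_pos M.xpos (posl c.ord T.2)
  split_ifs <;> simp [abs_mul, abs_of_pos h1]

/-- Every term that is not (non-zero and positive) is `≤ 0`. [folklore] -/
theorem tval_nonpos_of_not_pos (M : V19S.Model c x v) (T : Term) (hT : ∀ a ∈ T.2, a ∈ allAtoms)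
    (h : ¬ (termZero c T = false ∧ termNeg c T = false)) : tval v T ≤ 0 := by
  by_cases hz : termZero c T = true
  · exact (tval_eq_zero_of_termZero M T hT hz).le
  · have hz' : termZero c T = false := by simpa using hz
    have hn : termNeg c T = true := by
      by_contra hn'
      exact h ⟨hz', by simpa using hn'⟩
    exact tval_nonpos_of_termNeg M T hT hz' hn

/-! ### Slots of valid atoms are `< 21` -/

/-- Slots (positions) of valid atoms are `< 21`. [folklore] -/
theorem posl_lt_21 (M : V19S.Model c x v) {A : List Atom} (hA : ∀ a ∈ A, a ∈ allAtoms) : ∀ p ∈ posl c.ord A, p < 21 := by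
  intro p hp
  rw [posl_ord, List.mem_map] at hp
  obtain ⟨a, ha, rfl⟩ := hp
  exact M.slot_lt (hA a ha)

/-! ### Positive terms and the single-positive-term lemma -/

/-- Characterisation of the (non-zero) positive terms. [folklore] -/
theorem mem_posTerms_iff {P : List Term} {n : ℕ} (hn : n < P.length) :
    n ∈ V19S.posTerms c P ↔ termZero c (P.getD n (0, [])) = false ∧ termNeg c (P.getD n (0, [])) = false := by
  unfold posTerms
  rw [List.mem_filter, List.mem_range, List.getD_eq_getElem?_getD, List.getElem?_eq_getElem hn]
  simp [hn]

/-- Members of `posTerms` are indices. [folklore] -/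
theorem lt_length_of_mem_posTerms {P : List Term} {n : ℕ} (hn : n ∈ V19S.posTerms c P) : n < P.length := by
  unfold posTerms at hn
  exact List.mem_range.1 (List.mem_filter.1 hn).1

/-- In a single-positive polynomial with `pval ≥ 0`, the non-zero negative terms over a duplicate-free index list `S` (not containing the
positive index) have total absolute value at most the positive term, which is `≥ 0`. [folklore] -/
theorem sum_abs_le_pos (M : V19S.Model c x v) (P : PolySpec) (hP : P.valid = true) {p : ℕ}
    (hpos : posTerms c P.poly = [p]) (hval : 0 ≤ pval v P.poly)
    (S : List ℕ) (hS : ∀ j ∈ S, j < P.poly.length ∧ j ≠ p) (hSnd : S.Nodup) :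
    (S.map fun j => |tval v (P.poly.getD j (0, []))|).sum ≤ tval v (P.poly.getD p (0, [])) ∧
      0 ≤ tval v (P.poly.getD p (0, [])) := by
  classical
  set w : ℕ → ℝ := fun n => tval v (P.poly.getD n (0, [])) with hw
  have hp : p < P.poly.length := lt_length_of_mem_posTerms (c := c) (by rw [hpos]; simp)
  have hneg : ∀ n, n < P.poly.length → n ≠ p → w n ≤ 0 := by
    intro n hn hnp
    have hn' : n ∉ posTerms c P.poly := by rw [hpos]; simpa using hnp
    rw [mem_posTerms_iff hn] at hn'
    exact tval_nonpos_of_not_pos M _ (fun a ha => atoms_valid P hP _ (term_getD_mem _ hn) a ha) hn'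
  set T := (Finset.range P.poly.length).erase p with hT
  have hsplit : pval v P.poly = w p + ∑ n ∈ T, w n := by
    rw [pval_eq_sum_range, ← Finset.add_sum_erase _ _ (Finset.mem_range.2 hp)]
  have hTnonpos : ∑ n ∈ T, w n ≤ 0 :=
    Finset.sum_nonpos fun n hn => by
      rw [hT, Finset.mem_erase, Finset.mem_range] at hn
      exact hneg n hn.2 hn.1
  have hsub : S.toFinset ⊆ T := by
    intro j hj
    rw [List.mem_toFinset] at hj
    rw [hT, Finset.mem_erase, Finset.mem_range]
    exact ⟨(hS j hj).2, (hS j hj).1⟩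
  have hTS : ∑ n ∈ T, w n ≤ ∑ n ∈ S.toFinset, w n := by
    have h := Finset.sum_le_sum_of_subset_of_nonneg (f := fun n => -w n) hsub (fun i hi _ => by
      rw [hT, Finset.mem_erase, Finset.mem_range] at hi
      have := hneg i hi.2 hi.1
      linarith)
    rw [Finset.sum_neg_distrib, Finset.sum_neg_distrib] at h
    linarith
  have hSsum : ∑ n ∈ S.toFinset, w n = (S.map w).sum := List.sum_toFinset w hSnd
  have habs : (S.map fun j => |w j|) = S.map fun j => -w j :=
    List.map_congr_left fun j hj => abs_of_nonpos (hneg j (hS j hj).1 (hS j hj).2)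
  have hsumneg : ∀ L : List ℕ, (L.map fun j => -w j).sum = -(L.map w).sum := by
    intro L
    induction L with
    | nil => simp
    | cons a L ih => simp only [List.map_cons, List.sum_cons, ih]; ring
  refine ⟨?_, by linarith⟩
  show (S.map fun j => |w j|).sum ≤ w p
  rw [habs, hsumneg S]
  linarith

end Terms

end Summit.ValiantsHypothesis.ValiantsHypothesis.Theorems.LacunarySymmetroidMatrixDescartes.Census.V19S
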